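import Summits.ABC.ABC.Theorems.DefiniteXiFreyModularityIsModular
import Literature.NumberTheory.Automorphic.BrandtXi
import Literature.NumberTheory.EllipticCurves.CongruenceNumber
import HarnessLib

/-!
# STUB-IDEAS k1 gen 28 — `stub_xiDegreeComparison` (crux `SteinbergCore`, stmt-ABC-15024)

Sanity sketch (statements only + trivial glue): the registered stub signature verbatim (`StubSig`) and the
LITERATURE-CLOSURE riders H-C″: once helper 10 of the critic's cut lands
(`…SteinbergCoreXi.StubIdeasK1G11.stub_xiDegreeComparison_of_facts :
  padicValNat_congruenceNumber_eq_of_not_sq_dvd → DefiniteXi.FreyModularity → StubSig`),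
the stub is closed modulo NAMED LITERATURE FACTS ONLY (no route item), through the landed
`Summit.ABC.ABC.Theorems.freyModularity_of_exists_isNewformOf'` (BCDT Thm A) or
`…freyModularity_of_CDT_theorem_7_1_2'` (CDT 1999 Thm 7.1.2, enough for Frey curves).
-/

set_option linter.dupNamespace false

namespace Summit.ABC.ABC.Cruxes.SteinbergCore.StubIdeasK1G28

open Literature.NumberTheory.EllipticCurves Literature.NumberTheory.Automorphic
open Literature.NumberTheory.EllipticCurves.ModularForms

/-- The registered stub `stub_xiDegreeComparison`, verbatim (child 1 `XiDegreeComparison`). -/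
def StubSig : Prop :=
    ∀ ε : ℝ, 0 < ε → ∃ C : ℝ, ∀ a b : ℤ, IsCoprime a b → a * b * (a + b) ≠ 0 → ∀ (N : ℕ) [NeZero N],
      (Literature.NumberTheory.EllipticCurves.freyCurve a b).conductorNorm ℤ = N →
      ∀ Nm : ℕ, Odd Nm → Squarefree Nm → Odd Nm.primeFactors.card → Nm ∣ N →
      Literature.NumberTheory.Automorphic.brandtXi (N / Nm) Nm
          (fun n => (Literature.NumberTheory.EllipticCurves.freyCurve a b).LFunction n) ≠ 0 →
      ∃ D : Literature.NumberTheory.EllipticCurves.ModularForms.ModularParametrizationData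
        (Literature.NumberTheory.EllipticCurves.freyCurve a b) N,
        (∀ D' : Literature.NumberTheory.EllipticCurves.ModularForms.ModularParametrizationData
          (Literature.NumberTheory.EllipticCurves.freyCurve a b) N, D.deg ≤ D'.deg) ∧
        ((Literature.NumberTheory.Automorphic.brandtXi (N / Nm) Nm
              (fun n => (Literature.NumberTheory.EllipticCurves.freyCurve a b).LFunction n) /
            (ordProj[2] (Literature.NumberTheory.Automorphic.brandtXi (N / Nm) Nm
                (fun n => (Literature.NumberTheory.EllipticCurves.freyCurve a b).LFunction n)) *
              ordProj[3] (Literature.NumberTheory.Automorphic.brandtXi (N / Nm) Nm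
                (fun n => (Literature.NumberTheory.EllipticCurves.freyCurve a b).LFunction n))) : ℕ) : ℝ) ≤
          C * (N : ℝ) ^ ε * ((D.deg / (ordProj[2] D.deg * ordProj[3] D.deg) : ℕ) : ℝ) *
            ((∏ q ∈ N.primeFactors, ((Literature.NumberTheory.EllipticCurves.freyCurve a b).minimalDiscriminantNorm
              ℤ).factorization q : ℕ) : ℝ) ^ 3

/-- **H-A** (the ONLY open mathematics of the line besides modularity; k1 g17 / critic helper 7, verbatim):
one direction of ARS 2012 Thm 2.1(b) on Frey data, `p ≥ 5`. [cite: AgasheRibetStein2012, Thm. 2.1] -/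
def OneSidedARSFrey : Prop :=
  ∀ (a b : ℤ), IsCoprime a b → a * b * (a + b) ≠ 0 →
    ∀ (N : ℕ) [NeZero N], (freyCurve a b).conductorNorm ℤ = N →
    ∀ (D : ModularParametrizationData (freyCurve a b) N) (p : ℕ), p.Prime → 5 ≤ p →
      padicValNat p (congruenceNumber D.f) ≤ padicValNat p D.modularDegree

/-- **H-C″ (rider, 3 lines once helper 10 is landed): literature closure via BCDT Thm A.** -/
theorem stub_of_literature
    (hXi10 : padicValNat_congruenceNumber_eq_of_not_sq_dvd →
      Summit.ABC.ABC.Theses.DefiniteXi.FreyModularity → StubSig)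
    (hARS : padicValNat_congruenceNumber_eq_of_not_sq_dvd) (hA : exists_isNewformOf) : StubSig :=
  hXi10 hARS (Summit.ABC.ABC.Theorems.freyModularity_of_exists_isNewformOf' hA)

/-- **H-C″ variant: CDT 1999 Thm 7.1.2 suffices for Frey curves** (conductor not divisible by 27). -/
theorem stub_of_literature_CDT
    (hXi10 : padicValNat_congruenceNumber_eq_of_not_sq_dvd →
      Summit.ABC.ABC.Theses.DefiniteXi.FreyModularity → StubSig)
    (hARS : padicValNat_congruenceNumber_eq_of_not_sq_dvd) (h712 : BCDT.CDT_theorem_7_1_2) : StubSig :=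
  hXi10 hARS (Summit.ABC.ABC.Theorems.freyModularity_of_CDT_theorem_7_1_2' h712)

/-- **H-C‴: the same with the weaker one-sided input** (helper 10's `…_of_oneSidedARSFrey`). -/
theorem stub_of_oneSided_literature
    (hXi10 : OneSidedARSFrey → Summit.ABC.ABC.Theses.DefiniteXi.FreyModularity → StubSig)
    (hF : OneSidedARSFrey) (hA : exists_isNewformOf) : StubSig :=
  hXi10 hF (Summit.ABC.ABC.Theorems.freyModularity_of_exists_isNewformOf' hA)

end Summit.ABC.ABC.Cruxes.SteinbergCore.StubIdeasK1G28
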